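import Literature.AlgebraicGeometry.Resolution.StrictlyStandardElements
import Mathlib.RingTheory.TensorProduct.Quotient
import Mathlib.RingTheory.Extension.Presentation.Basic
import HarnessLib

/-!
# Base change of strictly standard elements (Stacks, Lemma 07CC)

Topic: `Literature/AlgebraicGeometry/Resolution`. Support file of the INLINE proofs of the named
facts `Stacks07FE_resolveSpecial` / `Stacks07F5_reduceToField` (`NeronPopescuSteps.lean`): the
base change property of Definition 07C7 (`IsStrictlyStandard`, `StrictlyStandardElements.lean`)
used in Lemma 07F8 ("Note that property (2) is preserved by Lemma 07CC") and in Lemma 07CT.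
Stacks, Lemma 07CC: "Let `R → A` be a ring map of finite presentation. Let `a ∈ A`. Consider
the following conditions on `a`: (1) `A_a` is smooth over `R`, (2) `A_a` is smooth over `R` and
`Ω_{A_a/R}` is stably free, (3) `A_a` is smooth over `R` and `Ω_{A_a/R}` is free, (4) `A_a` is
standard smooth over `R`, (5) `a` is strictly standard in `A` over `R`, (6) `a` is elementary
standard in `A` over `R`. … these properties are preserved under base change: given `R → R'`,
`A' = R' ⊗_R A`, the element `a ⊗ 1` of `A'` has the corresponding property." This file PROVES
the strictly standard case (5) (sorry-free, no named facts):

* `IsStrictlyStandard.of_algEquiv` — invariance under `R`-algebra isomorphisms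
  (`Algebra.Presentation.ofAlgEquiv`);
* `IsStrictlyStandard.baseChange` — **07CC (5)**: `1 ⊗ a` is strictly standard in `T ⊗_R A`
  over `T` (`Algebra.Presentation.baseChange`; the Jacobian minors and conditions (16.2.3.3),
  (16.2.3.4) are compatible with `R[x] → T[x]`, the latter checked on one lift by
  `liftCond_of_exists`);
* `IsStrictlyStandard.quotient_map` — the form used in 07F8: the image of `a` in `A/IA` is
  strictly standard over `R/I` (`A/IA ≅ (R/I) ⊗_R A`,
  `Algebra.TensorProduct.quotIdealMapEquivQuotTensor`).

## Sources

* The Stacks Project, *Smoothing Ring Maps* (Tag 07BW), Lemma 07CC, Definition 07C7, and the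
  use of 07CC in the proofs of Lemmas 07F8 and 07CT. [StacksProject]
-/

noncomputable section

namespace Literature.AlgebraicGeometry.Resolution

universe u

open MvPolynomial TensorProduct

section BaseChange

variable {R A : Type u} [CommRing R] [CommRing A] [Algebra R A]

/-- Strict standardness is invariant under isomorphisms of `R`-algebras (transport the
presentation). [folklore] -/
theorem IsStrictlyStandard.of_algEquiv {B : Type u} [CommRing B] [Algebra R B] (e : A ≃ₐ[R] B)
    {a : A} (h : IsStrictlyStandard R a) : IsStrictlyStandard R (e a) := by
  classical
  obtain ⟨n, m, P, c, hcn, hcm, ⟨coef, ha⟩, hcond⟩ := h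
  let P' : Algebra.Presentation R B (Fin n) (Fin m) := P.ofAlgEquiv e
  have hval : ∀ p : MvPolynomial (Fin n) R, aeval P'.val p = e (aeval P.val p) := fun p => by
    change aeval (fun i => (e : A →ₐ[R] B) (P.val i)) p = _
    rw [← MvPolynomial.comp_aeval, AlgHom.comp_apply]
    rfl
  have hrel : P'.relation = P.relation := rfl
  refine ⟨n, m, P', c, hcn, hcm, ⟨fun ι => e (coef ι), ?_⟩, ?_⟩
  · rw [ha, map_sum]
    exact Finset.sum_congr rfl fun ι _ => by rw [map_mul, hrel, hval]
  · intro p hp j hj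
    have hp' : aeval P.val p = a := e.injective (by rw [← hval, hp])
    have hker : P'.ker = P.ker := by
      rw [← P'.span_range_relation_eq_ker, ← P.span_range_relation_eq_ker, hrel]
    rw [hrel, hker]
    exact hcond p hp' j hj

/-- Jacobian minors commute with a change of coefficient ring (cf. `jacobianMinor_map` of
`NeronPopescuClearDenominatorsCore.lean`). [folklore] -/
private theorem jacobianMinor_map_algebraMap (T : Type u) [CommRing T] [Algebra R T] {N m c : ℕ}
    (f : Fin m → MvPolynomial (Fin N) R) (hc : c ≤ m) (e : Fin c → Fin N) :
    jacobianMinor (fun j => MvPolynomial.map (algebraMap R T) (f j)) hc e =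
      MvPolynomial.map (algebraMap R T) (jacobianMinor f hc e) := by
  unfold jacobianMinor
  rw [RingHom.map_det, RingHom.mapMatrix_apply]
  congr 1
  refine Matrix.ext fun i j => ?_
  rw [Matrix.map_apply, Matrix.of_apply, Matrix.of_apply, pderiv_map]

/-- **Stacks, Lemma 07CC** (base change of strictly standard elements): "Let `R → A` be a ring
map of finite presentation. Let `a ∈ A`. … (2) If `a` is strictly standard in `A` over `R`,
then `a ⊗ 1` is strictly standard in `A ⊗_R R'` over `R'` [for any ring map `R → R'`]."
Proof as printed: base change the presentation `A = R[x]/(f_1, …, f_m)` to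
`A ⊗_R R' = R'[x]/(f'_1, …, f'_m)`; the Jacobian minors and the conditions (16.2.3.3),
(16.2.3.4) are compatible with `R[x] → R'[x]`. [cite: StacksProject, Tag 07CC] -/
theorem IsStrictlyStandard.baseChange (T : Type u) [CommRing T] [Algebra R T] {a : A}
    (h : IsStrictlyStandard R a) : IsStrictlyStandard T ((1 : T) ⊗ₜ[R] a : T ⊗[R] A) := by
  classical
  obtain ⟨n, m, P, c, hcn, hcm, ⟨coef, ha⟩, hcond⟩ := h
  let P' : Algebra.Presentation T (T ⊗[R] A) (Fin n) (Fin m) := P.baseChange T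
  have hrel : ∀ j, P'.relation j = MvPolynomial.map (algebraMap R T) (P.relation j) := fun j => rfl
  have hval' : P'.val = fun x => (1 : T) ⊗ₜ[R] P.val x := rfl
  -- `aeval P'.val (map p) = 1 ⊗ aeval P.val p`
  have hval : ∀ p : MvPolynomial (Fin n) R,
      aeval P'.val (MvPolynomial.map (algebraMap R T) p) = (1 : T) ⊗ₜ[R] aeval P.val p := by
    intro p
    rw [MvPolynomial.aeval_map_algebraMap, hval']
    have : (aeval fun x => (1 : T) ⊗ₜ[R] P.val x : MvPolynomial (Fin n) R →ₐ[R] T ⊗[R] A) =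
        (Algebra.TensorProduct.includeRight : A →ₐ[R] T ⊗[R] A).comp (aeval P.val) := by
      rw [MvPolynomial.comp_aeval]
      rfl
    rw [this, AlgHom.comp_apply, Algebra.TensorProduct.includeRight_apply]
  refine ⟨n, m, P', c, hcn, hcm, ⟨fun ι => (1 : T) ⊗ₜ[R] coef ι, ?_⟩, ?_⟩
  · -- (16.2.3.3)
    have hmin : ∀ ι : Fin c → Fin n, jacobianMinor P'.relation hcm ι =
        MvPolynomial.map (algebraMap R T) (jacobianMinor P.relation hcm ι) := fun ι => by
      rw [show P'.relation = fun j => MvPolynomial.map (algebraMap R T) (P.relation j) from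
        funext hrel]
      exact jacobianMinor_map_algebraMap T P.relation hcm ι
    rw [ha, ← Algebra.TensorProduct.includeRight_apply, map_sum]
    refine Finset.sum_congr rfl fun ι _ => ?_
    rw [map_mul, hmin, hval, Algebra.TensorProduct.includeRight_apply,
      Algebra.TensorProduct.includeRight_apply]
  · -- (16.2.3.4), checked on the lift `map p₀`
    obtain ⟨p₀, hp₀⟩ := P.aeval_val_surjective a
    refine liftCond_of_exists (MvPolynomial.map (algebraMap R T) p₀) (by rw [hval, hp₀]) ?_
    intro j hj
    have hmem := hcond p₀ hp₀ j hj
    have hmap := Ideal.mem_map_of_mem (MvPolynomial.map (algebraMap R T)) hmem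
    rw [hrel j, ← map_mul]
    refine (show (Ideal.span (Set.range (P.relation ∘ Fin.castLE hcm)) ⊔ P.ker ^ 2).map
        (MvPolynomial.map (algebraMap R T)) ≤
        Ideal.span (Set.range (P'.relation ∘ Fin.castLE hcm)) ⊔ P'.ker ^ 2 from ?_) hmap
    rw [Ideal.map_sup, Ideal.map_pow, Ideal.map_span, ← Set.range_comp]
    refine sup_le_sup (le_of_eq ?_) (Ideal.pow_right_mono ?_ 2)
    · rfl
    · rw [← P.span_range_relation_eq_ker, ← P'.span_range_relation_eq_ker, Ideal.map_span,
        ← Set.range_comp]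
      rfl

/-- **Stacks, Lemma 07CC for quotients of the base**: the image of a strictly standard
`a ∈ A` in `A/IA` is strictly standard over `R/I` (`A/IA = A ⊗_R R/I`).
[cite: StacksProject, Tag 07CC] -/
theorem IsStrictlyStandard.quotient_map (I : Ideal R) {a : A} (h : IsStrictlyStandard R a) :
    IsStrictlyStandard (R ⧸ I) (Ideal.Quotient.mk (I.map (algebraMap R A)) a) := by
  have h1 := h.baseChange (R ⧸ I)
  have h2 := h1.of_algEquiv (Algebra.TensorProduct.quotIdealMapEquivQuotTensor A I).symm
  convert h2 using 1
  symm
  rw [AlgEquiv.symm_apply_eq, Algebra.TensorProduct.quotIdealMapEquivQuotTensor_mk]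

end BaseChange

end Literature.AlgebraicGeometry.Resolution

end
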